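import Literature.MathematicalPhysics.QuantumFieldTheory.Balaban1983to89.B1Eq324BenfattoClassSectEMember
import Literature.MathematicalPhysics.QuantumFieldTheory.Balaban1983to89.B9CoReadingCoordsTranspose

/-!
# `Balaban1983to89.B1Eq324BenfattoClassSectEMemberCoRead` — THE (3.24) SECT. E DOORS OF `…ClassSectEMember` READ IN REAL ORTHONORMAL FIBRE
# COORDINATES OF AN OPERATOR: the member rows (symmetry, `γ₀`/`γ₁` form bounds, exponential decay, the inverse) of the real coordinate matrix of an
# ℝ-linear operator on `X → 𝔸` along a sub-carrier, FROM the same rows in OPERATOR currency (seat dag-n08-b gen 32; node N08 [Balaban1985UV3], row `h324c`)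

statement-level companion of a published source with citation tags; every declaration here is a theorem; nothing here is a claim about the
Yang–Mills mass gap

THE PRINTED LOCUS.  [Balaban1985BackgroundPropagators] (= [B9]) Sect. E p. 428: *"⟨B,(QG₁Q*)⁻¹B⟩ − a⟨B,B⟩ − 2⟨H₁D̃⁽²⁾(B), J⟩ = ⟨B, Δ_kB⟩ (3.156).
This form is considered on the subspace {B : B = 0 on Λᶜ, …}. We can parametrize this subspace … using part of the variables B, which we denote by B̃.
These are variables B restricted to the set of bonds Λ̃ … B = CB̃ … (C*Δ_kC)⁻¹ = C̃^{(k)}(Λ) = C^{(k)}(Λ)↾_Λ̃ (3.158) … it is defined by a positive definite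
operator C*Δ_kC with a lower bound γ₀ > 0 independent of k and U … a uniform exponential decay of C*Δ_kC"*; p. 389: *"A is a function defined on bonds,
with values in the Lie algebra 𝔤"*; p. 392–393: the scalar products `X·Y = tr XY` summed over the lattice; Thm 3.15 p. 432 (3.187): *"|C^{(k)}(Λ; y, y′)| ≤
B₀e^{−δ₀|y−y′|}"*.  [Balaban1985UV3] (= [B10]) p. 271: *"we obtain the Gaussian integral determined by the positive quadratic form ⟨A, C*Δ_kCA⟩ … γ₁ is
an upper bound of the positive, bounded operator C*Δ_kC"*; (24) p. 262 cites [Balaban1982Higgs1] (3.24) for the cumulant remainder (node N08's row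
`h324c`).

WHY THIS MODULE (cell `pub-ymgap`, seat `dag-n08-b` gen 32, CLAIM-5; the located «ℝ-reading composition» of the seat's HANDOFF §gen 29∕31 and of seat
n08-d's located memo g20∕g25 (A)).  The seat's gen-15 doors `…ClassSectEMember.eq324_torus_of_expDecay_on_unit` ∕ `eq324_sectECovariance_torus_on_unit`
deliver [Balaban1982Higgs1] (3.24) for the Gaussian field of a Sect.-E member on a labelled torus block GIVEN ITS MEMBER ROWS AS A REAL MATRIX `T : Matrix β β ℝ`
(symmetric, `γ₀`-coercive, `e^{−δρ}`-decaying; resp. `γ₀ ≤ T ≤ γ₁` and the decay of `T⁻¹`).  The cell's Sect.-E letters of record are OPERATORS — def-Y's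
`Node00.OpsYSectE.CsDeltaCY` ∕ `CtildeKY` act `ℂ`-linearly on `𝔸`-valued functions on the index-bond carrier, `𝔸 = M_N(ℂ) ⊃ 𝔤`, and node N06's rows
about them are operator statements (trace-pairing symmetry `B9Thm311ReadingCoords.IsSymmTr`, trace-form positivity, the unit-ball kernel reading
`sup_{‖E‖≤1}‖(T(δ_{y′} ⊗ E))(y)‖` of `Node00.siteKernelOfOp`, the sector inverse `corner_mul_secInvY`).  THIS FILE is the dictionary between the two
currencies, so that the member half of the IDENT for row `h324c` can be stated at the operator letters WITHOUT a matrix intermediary: for an ℝ-linear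
`A` on `X → 𝔸`, a frame `e : F → 𝔸` orthonormal for a symmetric real pairing `β` on the fibre (an orthonormal basis of `𝔤` for `−Re tr XY`, or seat n06-d's
`trBasis N` of `M_N(ℂ)` for `Re tr(XᴴY)`), and a sub-carrier `ι : S ↪ X` (print's `Λ̃ ⊂ Λ`), the coordinate matrix
`𝕄 p q := β (e p.2) ((A(δ_{ι q.1} ⊗ e_{q.2}))(ι p.1))` on `S × F` inherits every member row from the operator row.

WHAT IS PROVED (standard axioms; no `sorry`; no definition — `𝕄` is written out as `Matrix.of fun p q => β (e p.2) (A (Pi.single (ι q.1) (e q.2)) (ι p.1))`).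
* §1 (generic `X`, real `𝔸`, `β`, `e`, `ι`, `A`): `sum_pairing_single` · `sum_pairing_assemble` (`Σ_x β(Φ_v x, W x) = Σ_q v_q β(e_{q.2}, W(ι q.1))` for the
  frame-assembled `Φ_v = Σ_q v_q δ_{ι q.1} ⊗ e_{q.2}`) · `coord_single` ∕ `coord_assemble` (orthonormal coordinates read back) · `assemble_eq_zero_of_not_mem_range` ∕
  `assemble_mem_span` (Φ_v is supported on `ι(S)` and frame-valued) · `exists_assemble_of_support_mem_span` (and conversely: such a function IS a `Φ_v`) ·
  `frameRead_of_sectorIdentity` · ★ `mulVec_coordMatrix` (`(𝕄v)_p = β(e_{p.2}, (AΦ_v)(ι p.1))`) · ★★ `form_coordMatrix`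
  (`ΣΣ 𝕄 p q v_p v_q = Σ_x β(Φ_v x, AΦ_v x)`) · ★ `sq_sum_eq_pairing_assemble` (`Σ v² = Σ_x β(Φ_v x, Φ_v x)`) · ★★ `coordMatrix_symm_of_selfAdjoint` ·
  ★★ `coercive_coordMatrix` ∕ `form_le_coordMatrix` (the `γ₀` ∕ `γ₁` rows) · ★★ `coordMatrix_mul_coordMatrix_sectorInverse` ∕ `inv_coordMatrix_eq` (a sector
  inverse `Ã` — `AÃ = 1` read on the frame over `ι(S)`, `Ã` frame-valued there — has `𝕄(Ã) = 𝕄(A)⁻¹`).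
* §2 (normed fibre): `kernelReading_homog_of_ball` (the unit-ball reading ⇒ the homogeneous reading `‖(A(δ_{x′} ⊗ E))(x)‖ ≤ K‖E‖e^{−δρ}`) · ★★
  `abs_coordMatrix_le` (`|𝕄 p q| ≤ c_β n_e K e^{−δρ(p.1,q.1)}`); §2b def-Y's readings BY NAME: ★ `norm_le_of_iSup_closedBall_le` (a bound on the `iSup`
  over the closed unit ball — the shape of `Node00.siteKernelOfOp` — bounds every direction; finite-dimensional fibre) · `deltaY_eq_single`
  (`Node00.deltaY w E = Pi.single w E`).
* §3 ★★★ `eq324_coordMatrix_torus_on_unit` — the precision one-stop `eq324_torus_of_expDecay_on_unit` at `β := S × F`, `T := 𝕄(A)`, with EVERY member row in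
  operator currency (β-self-adjointness; `γ₀Σ_xβ(Φx,Φx) ≤ Σ_xβ(Φx,AΦx)` on `ι(S)`-supported frame-valued `Φ`; the homogeneous kernel reading); ★★★
  `eq324_coordMatrix_torusCovariance_on_unit` — the covariance door `eq324_sectECovariance_torus_on_unit` at `T := 𝕄(A)` with `γ₀ ≤ A ≤ γ₁` in operator
  currency and the (3.187)-side row supplied by the kernel reading of a sector inverse `Ã` (print's `C̃^{(k)} = (C*Δ_kC)⁻¹`, (3.158)).
* §4 (fibre `M_N(ℂ)`, seat n06-d's `trBasis N`, seat n06-j's `trIP 1` ∕ `IsSymmTr 1`): `trReForm_trBasis_trBasis` (orthonormality INHABITED) ·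
  `trReForm_trBasis_eq_repr` · `selfAdjoint_of_isSymmTr` · ★ `coordMatrix_symm_trBasis_of_isSymmTr` · ★ `coercive_coordMatrix_trBasis_of_trIP` ∕
  `form_le_coordMatrix_trBasis_of_trIP` — the symmetry, `γ₀` and `γ₁` rows of a `ℂ`-linear letter read at the cell's trace-currency predicates.
* Two `example`s: the scalar side of the §3 doors elaborates end to end.
HONEST SCOPE.  Count-neutral finite-dimensional real linear algebra and two compositions BY NAME; node N06's Sect.-E rows stay DISPLAYED hypotheses (now
in operator currency); NO letter of NODE 00 is pinned here — the IDENT (which `A` = def-Y's `CsDeltaCY x 𝔏 𝔢 U`, which `S` = the `Λ̃`-bonds, which frame of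
`𝔤`, and `(𝔖 k).μ = 𝒩(0, 𝕄⁻¹).map Φ`) is NOT made, NOT commissioned, NOT claimed; seat n08-d's CLAIM-82 (the index presentation `(site, lab, ρ)` at NODE 00's
bonds) is the other, independent half; nothing of [Balaban1985UV3], [Balaban1985BackgroundPropagators], [Balaban1982Higgs1] or [BenfattoEtAl1978] is
asserted or discharged; node N08 is NOT discharged; nothing about d = 4, the continuum, OS axioms, a mass gap or the Clay problem.
-/

noncomputable section

open MeasureTheory Finset Matrix

namespace Literature.MathematicalPhysics.QuantumFieldTheory.Balaban1983to89.B1Eq324BenfattoClassSectEMemberCoRead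

open Literature.MathematicalPhysics.QuantumFieldTheory
open Literature.MathematicalPhysics.QuantumFieldTheory.Balaban1983to89.B1Eq324BenfattoLemma
open Literature.MathematicalPhysics.QuantumFieldTheory.Balaban1983to89.B1Eq324BenfattoClassSectEMember
  (eq324_torus_of_expDecay_on_unit eq324_sectECovariance_torus_on_unit)

/-! ## §1  The coordinate matrix of an operator along an orthonormal frame and a sub-carrier: algebraic rows -/

section Frame

variable {X : Type*} [Fintype X] [DecidableEq X]
variable {𝔸 : Type*} [AddCommGroup 𝔸] [Module ℝ 𝔸]
variable {F : Type*} [Fintype F] [DecidableEq F]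
variable {S : Type*} [Fintype S] [DecidableEq S]
variable (β : 𝔸 →ₗ[ℝ] 𝔸 →ₗ[ℝ] ℝ) (e : F → 𝔸) (ι : S → X)

/-- pairing a function against a one-point function `δ_{x₀} ⊗ a` over the carrier picks the value at `x₀`: `Σ_x β((δ_{x₀} ⊗ a)(x), W x) = β(a, W x₀)`.
[cite: Balaban1985BackgroundPropagators, p.393 (scalar products summed over the lattice), bookkeeping] -/
theorem sum_pairing_single (x₀ : X) (a : 𝔸) (W : X → 𝔸) :
    ∑ x, β ((Pi.single x₀ a : X → 𝔸) x) (W x) = β a (W x₀) := by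
  rw [Finset.sum_eq_single x₀]
  · rw [Pi.single_eq_same]
  · intro x _ hx
    rw [Pi.single_eq_of_ne hx, map_zero, LinearMap.zero_apply]
  · intro h; exact absurd (Finset.mem_univ _) h

omit [DecidableEq F] [DecidableEq S] in
/-- pairing the frame-assembled function `Φ_v = Σ_q v_q·(δ_{ι q.1} ⊗ e_{q.2})` against `W` over the carrier: `Σ_x β(Φ_v x, W x) = Σ_q v_q·β(e_{q.2}, W(ι q.1))`
(bilinearity only — no orthonormality, no injectivity). [cite: Balaban1985BackgroundPropagators, p.393 (scalar products), p.428 (the variables B̃ on Λ̃), bookkeeping] -/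
theorem sum_pairing_assemble (v : S × F → ℝ) (W : X → 𝔸) :
    ∑ x, β ((fun x => ∑ q, v q • (Pi.single (ι q.1) (e q.2) : X → 𝔸) x) x) (W x) = ∑ q, v q * β (e q.2) (W (ι q.1)) := by
  have h : ∀ x, β (∑ q, v q • (Pi.single (ι q.1) (e q.2) : X → 𝔸) x) (W x) =
      ∑ q, v q * β ((Pi.single (ι q.1) (e q.2) : X → 𝔸) x) (W x) := by
    intro x
    rw [map_sum, LinearMap.sum_apply]
    exact Finset.sum_congr rfl fun q _ => by rw [map_smul, LinearMap.smul_apply, smul_eq_mul]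
  simp only [h]
  rw [Finset.sum_comm]
  exact Finset.sum_congr rfl fun q _ => by rw [← Finset.mul_sum, sum_pairing_single]

omit [Fintype X] [Fintype F] [Fintype S] in
/-- for an orthonormal frame (`β(e_c, e_{c′}) = δ_{cc′}`) and an injective sub-carrier, the `p`-th coordinate of the frame vector `δ_{ι q.1} ⊗ e_{q.2}` is
`δ_{pq}`. [cite: Balaban1985BackgroundPropagators, p.389 (𝔤-valued bond functions), p.393, bookkeeping] -/
theorem coord_single (he : ∀ c c', β (e c) (e c') = if c = c' then 1 else 0) (hι : Function.Injective ι) (p q : S × F) :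
    β (e p.2) ((Pi.single (ι q.1) (e q.2) : X → 𝔸) (ι p.1)) = if p = q then 1 else 0 := by
  by_cases h1 : p.1 = q.1
  · rw [h1, Pi.single_eq_same, he]
    by_cases h2 : p.2 = q.2
    · rw [if_pos h2, if_pos (Prod.ext h1 h2)]
    · rw [if_neg h2, if_neg (fun h => h2 (congrArg Prod.snd h))]
  · rw [Pi.single_eq_of_ne (fun h => h1 (hι h)), map_zero, if_neg (fun h => h1 (congrArg Prod.fst h))]

omit [Fintype X] in
/-- orthonormal coordinates read back: the `p`-th coordinate of `Φ_v` is `v_p`. [cite: Balaban1985BackgroundPropagators, p.393, bookkeeping] -/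
theorem coord_assemble (he : ∀ c c', β (e c) (e c') = if c = c' then 1 else 0) (hι : Function.Injective ι) (v : S × F → ℝ) (p : S × F) :
    β (e p.2) ((fun x => ∑ q, v q • (Pi.single (ι q.1) (e q.2) : X → 𝔸) x) (ι p.1)) = v p := by
  show β (e p.2) (∑ q, v q • (Pi.single (ι q.1) (e q.2) : X → 𝔸) (ι p.1)) = v p
  rw [map_sum]
  simp only [map_smul, smul_eq_mul, coord_single β e ι he hι]
  simp only [mul_ite, mul_one, mul_zero]
  rw [Finset.sum_ite_eq]
  simp

omit [Fintype X] [DecidableEq F] [DecidableEq S] in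
/-- the frame-assembled function vanishes off the sub-carrier `ι(S)` (print's «B = 0 on the complement»). [cite: Balaban1985BackgroundPropagators, p.428, bookkeeping] -/
theorem assemble_eq_zero_of_not_mem_range (v : S × F → ℝ) {x : X} (hx : x ∉ Set.range ι) :
    (fun x => ∑ q, v q • (Pi.single (ι q.1) (e q.2) : X → 𝔸) x) x = 0 := by
  show ∑ q, v q • (Pi.single (ι q.1) (e q.2) : X → 𝔸) x = 0
  refine Finset.sum_eq_zero fun q _ => ?_
  rw [Pi.single_eq_of_ne (fun h => hx ⟨q.1, h.symm⟩), smul_zero]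

omit [Fintype X] [DecidableEq F] [DecidableEq S] in
/-- the frame-assembled function takes values in the real span of the frame (print's «values in the Lie algebra 𝔤»). [cite: Balaban1985BackgroundPropagators, p.389, bookkeeping] -/
theorem assemble_mem_span (v : S × F → ℝ) (x : X) :
    (fun x => ∑ q, v q • (Pi.single (ι q.1) (e q.2) : X → 𝔸) x) x ∈ Submodule.span ℝ (Set.range e) := by
  show ∑ q, v q • (Pi.single (ι q.1) (e q.2) : X → 𝔸) x ∈ Submodule.span ℝ (Set.range e)
  refine Submodule.sum_mem _ fun q _ => Submodule.smul_mem _ _ ?_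
  rw [Pi.single_apply]
  split_ifs
  · exact Submodule.subset_span ⟨q.2, rfl⟩
  · exact Submodule.zero_mem _

omit [Fintype X] [DecidableEq S] in
/-- conversely, a function supported on `ι(S)` with values in the span of an orthonormal frame IS frame-assembled, with the `β`-coordinates as
coefficients (injective sub-carrier) — the bridge from the natural operator-currency description of print's B̃-variables («B = 0 on the complement»,
«values in 𝔤») to §1's parametrisation `Φ_v`. [cite: Balaban1985BackgroundPropagators, p.389, p.428, bookkeeping] -/
theorem exists_assemble_of_support_mem_span (he : ∀ c c', β (e c) (e c') = if c = c' then 1 else 0) (hι : Function.Injective ι)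
    (Φ : X → 𝔸) (hsupp : ∀ x, x ∉ Set.range ι → Φ x = 0) (hspan : ∀ x, Φ x ∈ Submodule.span ℝ (Set.range e)) :
    ∃ w : S × F → ℝ, Φ = fun x => ∑ r, w r • (Pi.single (ι r.1) (e r.2) : X → 𝔸) x := by
  refine ⟨fun r => β (e r.2) (Φ (ι r.1)), funext fun x => ?_⟩
  show Φ x = ∑ r : S × F, β (e r.2) (Φ (ι r.1)) • (Pi.single (ι r.1) (e r.2) : X → 𝔸) x
  by_cases hx : x ∈ Set.range ι
  · obtain ⟨s, rfl⟩ := hx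
    obtain ⟨a, ha⟩ := (Submodule.mem_span_range_iff_exists_fun ℝ).mp (hspan (ι s))
    -- the coefficients of a frame-span element are its `β`-coordinates
    have hcoef : ∀ c, β (e c) (Φ (ι s)) = a c := by
      intro c
      rw [← ha, map_sum]
      simp only [map_smul, smul_eq_mul, he, mul_ite, mul_one, mul_zero]
      rw [Finset.sum_ite_eq]
      simp
    rw [Fintype.sum_prod_type, Finset.sum_eq_single s]
    · simp only [Pi.single_eq_same, hcoef]
      exact ha.symm
    · intro s' _ hs'
      exact Finset.sum_eq_zero fun c _ => by rw [Pi.single_eq_of_ne (fun h => hs' (hι h).symm), smul_zero]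
    · intro h; exact absurd (Finset.mem_univ _) h
  · rw [hsupp x hx]
    symm
    exact Finset.sum_eq_zero fun r _ => by rw [Pi.single_eq_of_ne (fun h => hx ⟨r.1, h.symm⟩), smul_zero]

variable (A : (X → 𝔸) →ₗ[ℝ] (X → 𝔸))

omit [Fintype X] [Fintype F] [Fintype S] [DecidableEq F] [DecidableEq S] in
/-- the operator-level sector identity `(A(ÃΦ))(ι s) = Φ(ι s)` on the frame vectors (def-Y's `corner_mul_secInvY` shape `(PTP)·secInv = P`) gives §1's
frame-read hypothesis `hinv` of `coordMatrix_mul_coordMatrix_sectorInverse`. [cite: Balaban1985BackgroundPropagators, (3.158) p.428, bookkeeping] -/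
theorem frameRead_of_sectorIdentity (Ainv : (X → 𝔸) →ₗ[ℝ] (X → 𝔸))
    (h : ∀ (q : S × F) (s : S), A (Ainv (Pi.single (ι q.1) (e q.2))) (ι s) = (Pi.single (ι q.1) (e q.2) : X → 𝔸) (ι s)) (p q : S × F) :
    β (e p.2) (A (Ainv (Pi.single (ι q.1) (e q.2))) (ι p.1)) = β (e p.2) ((Pi.single (ι q.1) (e q.2) : X → 𝔸) (ι p.1)) := by
  rw [h]

omit [Fintype X] [DecidableEq F] [DecidableEq S] in
/-- ★ **THE COORDINATE MATRIX ACTS AS THE OPERATOR**: `(𝕄v)_p = β(e_{p.2}, (AΦ_v)(ι p.1))` for the frame-assembled `Φ_v`.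
[cite: Balaban1985BackgroundPropagators, (3.156)–(3.157) p.428 (the form in the variables B̃); Balaban1984PropagatorsII, (2.51) p.232 (operators read as kernels), dictionary] -/
theorem mulVec_coordMatrix (v : S × F → ℝ) (p : S × F) :
    ((Matrix.of fun p q : S × F => β (e p.2) (A (Pi.single (ι q.1) (e q.2)) (ι p.1))) *ᵥ v) p =
      β (e p.2) (A (fun x => ∑ q, v q • (Pi.single (ι q.1) (e q.2) : X → 𝔸) x) (ι p.1)) := by
  have hΦ : (fun x => ∑ q, v q • (Pi.single (ι q.1) (e q.2) : X → 𝔸) x) = ∑ q, v q • (Pi.single (ι q.1) (e q.2) : X → 𝔸) := by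
    funext x; rw [Finset.sum_apply]; rfl
  rw [hΦ, map_sum, Finset.sum_apply, map_sum]
  simp only [Matrix.mulVec, dotProduct, Matrix.of_apply, map_smul, Pi.smul_apply, smul_eq_mul]
  exact Finset.sum_congr rfl fun q _ => mul_comm _ _

omit [DecidableEq F] [DecidableEq S] in
/-- ★★ **THE QUADRATIC FORM OF THE COORDINATE MATRIX IS THE OPERATOR'S PAIRING FORM** on frame-assembled functions:
`Σ_pΣ_q 𝕄 p q·v_p·v_q = Σ_x β(Φ_v x, (AΦ_v) x)` — print's `⟨B̃, C*Δ_kC B̃⟩` read in coordinates.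
[cite: Balaban1985BackgroundPropagators, (3.156)–(3.157) p.428; Balaban1985UV3, p.271 («the positive quadratic form ⟨A, C*Δ_kCA⟩»), dictionary] -/
theorem form_coordMatrix (v : S × F → ℝ) :
    ∑ p, ∑ q, (Matrix.of fun p q : S × F => β (e p.2) (A (Pi.single (ι q.1) (e q.2)) (ι p.1))) p q * v p * v q =
      ∑ x, β ((fun x => ∑ q, v q • (Pi.single (ι q.1) (e q.2) : X → 𝔸) x) x)
        (A (fun x => ∑ q, v q • (Pi.single (ι q.1) (e q.2) : X → 𝔸) x) x) := by
  rw [sum_pairing_assemble]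
  refine Finset.sum_congr rfl fun p _ => ?_
  rw [← mulVec_coordMatrix β e ι A v p]
  simp only [Matrix.mulVec, dotProduct, Finset.mul_sum]
  exact Finset.sum_congr rfl fun q _ => by ring

/-- ★ **THE EUCLIDEAN NORM OF THE COORDINATES IS THE PAIRING NORM** (orthonormal frame, injective sub-carrier): `Σ_p v_p² = Σ_x β(Φ_v x, Φ_v x)`.
[cite: Balaban1985BackgroundPropagators, p.393 (scalar products), p.428 (⟨B,B⟩), dictionary] -/
theorem sq_sum_eq_pairing_assemble (he : ∀ c c', β (e c) (e c') = if c = c' then 1 else 0) (hι : Function.Injective ι) (v : S × F → ℝ) :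
    ∑ p, v p ^ 2 = ∑ x, β ((fun x => ∑ q, v q • (Pi.single (ι q.1) (e q.2) : X → 𝔸) x) x)
      ((fun x => ∑ q, v q • (Pi.single (ι q.1) (e q.2) : X → 𝔸) x) x) := by
  rw [sum_pairing_assemble]
  exact Finset.sum_congr rfl fun p _ => by rw [coord_assemble β e ι he hι, sq]

omit [Fintype F] [DecidableEq F] [Fintype S] [DecidableEq S] in
/-- ★★ **A PAIRING-SELF-ADJOINT OPERATOR HAS A SYMMETRIC COORDINATE MATRIX** (symmetric pairing, any frame, any sub-carrier): if
`Σ_x β(Ψ x, (AΦ) x) = Σ_x β((AΨ) x, Φ x)` for all `Φ, Ψ` ([B9] p.428 «a positive definite operator C*Δ_kC»; Thm 3.11 «symmetric»), then `𝕄 p q = 𝕄 q p`.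
[cite: Balaban1985BackgroundPropagators, Sect. E p.428, Thm 3.11 p.416; Balaban1985UV3, p.271, dictionary] -/
theorem coordMatrix_symm_of_selfAdjoint (hβ : ∀ a b, β a b = β b a)
    (hA : ∀ Φ Ψ : X → 𝔸, ∑ x, β (Ψ x) (A Φ x) = ∑ x, β (A Ψ x) (Φ x)) (p q : S × F) :
    (Matrix.of fun p q : S × F => β (e p.2) (A (Pi.single (ι q.1) (e q.2)) (ι p.1))) p q =
      (Matrix.of fun p q : S × F => β (e p.2) (A (Pi.single (ι q.1) (e q.2)) (ι p.1))) q p := by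
  simp only [Matrix.of_apply]
  rw [← sum_pairing_single β (ι p.1) (e p.2) (A (Pi.single (ι q.1) (e q.2))), hA]
  rw [show (∑ x, β (A (Pi.single (ι p.1) (e p.2)) x) ((Pi.single (ι q.1) (e q.2) : X → 𝔸) x)) =
      ∑ x, β ((Pi.single (ι q.1) (e q.2) : X → 𝔸) x) (A (Pi.single (ι p.1) (e p.2)) x) from
    Finset.sum_congr rfl fun x _ => hβ _ _]
  rw [sum_pairing_single]

/-- ★★ **THE `γ₀` ROW TRANSFERS** (orthonormal frame, injective sub-carrier): if `γ₀·Σ_x β(Φ x, Φ x) ≤ Σ_x β(Φ x, (AΦ) x)` for every `Φ` supported on `ι(S)`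
with values in the span of the frame (print's «lower bound γ₀ > 0» of `C*Δ_kC` on the B̃-variables), then `γ₀·Σ_p v_p² ≤ Σ_pΣ_q 𝕄 p q v_p v_q`.
[cite: Balaban1985BackgroundPropagators, Sect. E p.428 (γ₀; GAPS G-B9-09: asserted in print); Balaban1985UV3, p.271, dictionary] -/
theorem coercive_coordMatrix (he : ∀ c c', β (e c) (e c') = if c = c' then 1 else 0) (hι : Function.Injective ι) {γ : ℝ}
    (hco : ∀ Φ : X → 𝔸, (∀ x, x ∉ Set.range ι → Φ x = 0) → (∀ x, Φ x ∈ Submodule.span ℝ (Set.range e)) →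
      γ * ∑ x, β (Φ x) (Φ x) ≤ ∑ x, β (Φ x) (A Φ x)) (v : S × F → ℝ) :
    γ * ∑ p, v p ^ 2 ≤ ∑ p, ∑ q, (Matrix.of fun p q : S × F => β (e p.2) (A (Pi.single (ι q.1) (e q.2)) (ι p.1))) p q * v p * v q := by
  rw [form_coordMatrix, sq_sum_eq_pairing_assemble β e ι he hι]
  exact hco _ (fun x hx => assemble_eq_zero_of_not_mem_range e ι v hx) (assemble_mem_span e ι v)

/-- ★★ **THE `γ₁` ROW TRANSFERS**: if `Σ_x β(Φ x, (AΦ) x) ≤ γ₁·Σ_x β(Φ x, Φ x)` for every `Φ` supported on `ι(S)` with frame values ([B10] p.271 «γ₁ is an upper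
bound of the positive, bounded operator C*Δ_kC»), then `Σ_pΣ_q 𝕄 p q v_p v_q ≤ γ₁·Σ_p v_p²`. [cite: Balaban1985UV3, p.271; Balaban1985BackgroundPropagators, p.428, dictionary] -/
theorem form_le_coordMatrix (he : ∀ c c', β (e c) (e c') = if c = c' then 1 else 0) (hι : Function.Injective ι) {γ₁ : ℝ}
    (hup : ∀ Φ : X → 𝔸, (∀ x, x ∉ Set.range ι → Φ x = 0) → (∀ x, Φ x ∈ Submodule.span ℝ (Set.range e)) →
      ∑ x, β (Φ x) (A Φ x) ≤ γ₁ * ∑ x, β (Φ x) (Φ x)) (v : S × F → ℝ) :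
    ∑ p, ∑ q, (Matrix.of fun p q : S × F => β (e p.2) (A (Pi.single (ι q.1) (e q.2)) (ι p.1))) p q * v p * v q ≤ γ₁ * ∑ p, v p ^ 2 := by
  rw [form_coordMatrix, sq_sum_eq_pairing_assemble β e ι he hι]
  exact hup _ (fun x hx => assemble_eq_zero_of_not_mem_range e ι v hx) (assemble_mem_span e ι v)

omit [Fintype X] in
/-- ★★ **A SECTOR INVERSE HAS THE INVERSE COORDINATE MATRIX** (orthonormal frame, injective sub-carrier): if `Ã` maps every frame vector `δ_{ι q.1} ⊗ e_{q.2}`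
to an `ι(S)`-supported frame-valued function and `AÃ = 1` holds on the frame vectors when read in the frame over `ι(S)` (def-Y's sector identity
`(PTP)·secInv = P` for `P` = restriction to `Λ̃`, (3.158) `(C*Δ_kC)·C̃^{(k)} = 1` on the `Λ̃`-functions), then `𝕄(A)·𝕄(Ã) = 1`.
[cite: Balaban1985BackgroundPropagators, (3.157)–(3.158) p.428, dictionary] -/
theorem coordMatrix_mul_coordMatrix_sectorInverse (he : ∀ c c', β (e c) (e c') = if c = c' then 1 else 0) (hι : Function.Injective ι)
    (Ainv : (X → 𝔸) →ₗ[ℝ] (X → 𝔸))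
    (hval : ∀ q : S × F, ∃ w : S × F → ℝ,
      Ainv (Pi.single (ι q.1) (e q.2)) = fun x => ∑ r, w r • (Pi.single (ι r.1) (e r.2) : X → 𝔸) x)
    (hinv : ∀ p q : S × F, β (e p.2) (A (Ainv (Pi.single (ι q.1) (e q.2))) (ι p.1)) = β (e p.2) ((Pi.single (ι q.1) (e q.2) : X → 𝔸) (ι p.1))) :
    (Matrix.of fun p q : S × F => β (e p.2) (A (Pi.single (ι q.1) (e q.2)) (ι p.1))) *
        (Matrix.of fun p q : S × F => β (e p.2) (Ainv (Pi.single (ι q.1) (e q.2)) (ι p.1))) = 1 := by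
  ext p q
  obtain ⟨w, hw⟩ := hval q
  -- the `q`-th column of `𝕄(Ã)` is `w`
  have hcol : ∀ r : S × F, (Matrix.of fun p q : S × F => β (e p.2) (Ainv (Pi.single (ι q.1) (e q.2)) (ι p.1))) r q = w r := by
    intro r
    rw [Matrix.of_apply, hw]
    exact coord_assemble β e ι he hι w r
  rw [Matrix.mul_apply]
  simp only [hcol]
  have h := mulVec_coordMatrix β e ι A w p
  simp only [Matrix.mulVec, dotProduct] at h
  rw [h, ← hw, hinv, coord_single β e ι he hι, Matrix.one_apply]

omit [Fintype X] in
/-- ★★ consequently `𝕄(A)⁻¹ = 𝕄(Ã)` — the covariance `C̃^{(k)} = (C*Δ_kC)⁻¹` read in coordinates IS the inverse of the precision read in coordinates.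
[cite: Balaban1985BackgroundPropagators, (3.158) p.428, dictionary] -/
theorem inv_coordMatrix_eq (he : ∀ c c', β (e c) (e c') = if c = c' then 1 else 0) (hι : Function.Injective ι)
    (Ainv : (X → 𝔸) →ₗ[ℝ] (X → 𝔸))
    (hval : ∀ q : S × F, ∃ w : S × F → ℝ,
      Ainv (Pi.single (ι q.1) (e q.2)) = fun x => ∑ r, w r • (Pi.single (ι r.1) (e r.2) : X → 𝔸) x)
    (hinv : ∀ p q : S × F, β (e p.2) (A (Ainv (Pi.single (ι q.1) (e q.2))) (ι p.1)) = β (e p.2) ((Pi.single (ι q.1) (e q.2) : X → 𝔸) (ι p.1))) :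
    (Matrix.of fun p q : S × F => β (e p.2) (A (Pi.single (ι q.1) (e q.2)) (ι p.1)))⁻¹ =
      Matrix.of fun p q : S × F => β (e p.2) (Ainv (Pi.single (ι q.1) (e q.2)) (ι p.1)) :=
  Matrix.inv_eq_right_inv (coordMatrix_mul_coordMatrix_sectorInverse β e ι A he hι Ainv hval hinv)

end Frame

/-! ## §2  Normed fibre: the kernel reading ⇒ entrywise exponential decay of the coordinate matrix -/

section Decay

variable {X : Type*} [Fintype X] [DecidableEq X]
variable {𝔸 : Type*} [NormedAddCommGroup 𝔸] [NormedSpace ℝ 𝔸]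
variable {F : Type*} [Fintype F] [DecidableEq F]
variable {S : Type*} [Fintype S] [DecidableEq S]
variable (β : 𝔸 →ₗ[ℝ] 𝔸 →ₗ[ℝ] ℝ) (e : F → 𝔸) (ι : S → X) (A : (X → 𝔸) →ₗ[ℝ] (X → 𝔸))

omit [Fintype X] in
/-- **THE UNIT-BALL KERNEL READING IS HOMOGENEOUS**: def-Y's reading `sup_{‖E‖ ≤ 1} ‖(A(δ_{x′} ⊗ E))(x)‖ ≤ K(x,x′)` (`Node00.siteKernelOfOp`, the (3.187) ∕ (3.132)
rows) gives `‖(A(δ_{x′} ⊗ E))(x)‖ ≤ K(x,x′)·‖E‖` for EVERY `E` (scaling). [cite: Balaban1985BackgroundPropagators, (3.187) p.432, (3.132) p.422 (kernel bounds), bookkeeping] -/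
theorem kernelReading_homog_of_ball {x x' : X} {K : ℝ}
    (hball : ∀ E : 𝔸, ‖E‖ ≤ 1 → ‖A (Pi.single x' E) x‖ ≤ K) (E : 𝔸) :
    ‖A (Pi.single x' E) x‖ ≤ K * ‖E‖ := by
  by_cases hE : E = 0
  · subst hE
    rw [Pi.single_zero, map_zero, Pi.zero_apply, norm_zero, mul_zero]
  · have hn : 0 < ‖E‖ := norm_pos_iff.mpr hE
    have hunit : ‖(‖E‖⁻¹ : ℝ) • E‖ ≤ 1 := by
      rw [norm_smul, norm_inv, norm_norm, inv_mul_cancel₀ hn.ne']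
    have hdec : (Pi.single x' E : X → 𝔸) = ‖E‖ • (Pi.single x' ((‖E‖⁻¹ : ℝ) • E) : X → 𝔸) := by
      rw [← Pi.single_smul, smul_smul, mul_inv_cancel₀ hn.ne', one_smul]
    rw [hdec, map_smul, Pi.smul_apply, norm_smul, norm_norm, mul_comm]
    exact mul_le_mul_of_nonneg_right (hball _ hunit) hn.le

omit [Fintype X] [Fintype F] [DecidableEq F] [Fintype S] [DecidableEq S] in
/-- ★★ **THE KERNEL READING ⇒ ENTRYWISE DECAY OF THE COORDINATE MATRIX**: with `|β(e_c, v)| ≤ c_β‖v‖`, `‖e_c‖ ≤ n_e` and the homogeneous reading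
`‖(A(δ_{ι s′} ⊗ E))(ι s)‖ ≤ K‖E‖e^{−δρ(s,s′)}` along the sub-carrier: `|𝕄 p q| ≤ c_β·n_e·K·e^{−δρ(p.1,q.1)}` — print's «uniform exponential decay of C*Δ_kC»,
resp. (3.187) for `C̃^{(k)}`, in the class files' binder shape. [cite: Balaban1985BackgroundPropagators, Sect. E p.428, (3.187) p.432; Balaban1984PropagatorsII, p.250, dictionary] -/
theorem abs_coordMatrix_le {cβ ne K δ : ℝ} (hcβ : 0 ≤ cβ) (hK : 0 ≤ K) (ρ : S → S → ℝ)
    (hβn : ∀ (c : F) (v : 𝔸), |β (e c) v| ≤ cβ * ‖v‖) (hen : ∀ c, ‖e c‖ ≤ ne)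
    (hker : ∀ (s s' : S) (E : 𝔸), ‖A (Pi.single (ι s') E) (ι s)‖ ≤ K * ‖E‖ * Real.exp (-(δ * ρ s s'))) (p q : S × F) :
    |(Matrix.of fun p q : S × F => β (e p.2) (A (Pi.single (ι q.1) (e q.2)) (ι p.1))) p q| ≤
      cβ * ne * K * Real.exp (-(δ * ρ p.1 q.1)) := by
  rw [Matrix.of_apply]
  refine (hβn _ _).trans ?_
  have h1 := hker p.1 q.1 (e q.2)
  have h2 : K * ‖e q.2‖ * Real.exp (-(δ * ρ p.1 q.1)) ≤ K * ne * Real.exp (-(δ * ρ p.1 q.1)) :=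
    mul_le_mul_of_nonneg_right (mul_le_mul_of_nonneg_left (hen _) hK) (Real.exp_pos _).le
  calc cβ * ‖A (Pi.single (ι q.1) (e q.2)) (ι p.1)‖ ≤ cβ * (K * ne * Real.exp (-(δ * ρ p.1 q.1))) :=
        mul_le_mul_of_nonneg_left (h1.trans h2) hcβ
    _ = cβ * ne * K * Real.exp (-(δ * ρ p.1 q.1)) := by ring

end Decay

/-! ## §2b  def-Y's readings BY NAME: `deltaY` is `Pi.single`; the unit-ball SUP reading bounds every direction (finite-dimensional fibre) -/

section DefYReading

variable {X : Type*} [DecidableEq X]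
variable {𝔸 : Type*} [NormedAddCommGroup 𝔸] [NormedSpace ℝ 𝔸] [FiniteDimensional ℝ 𝔸]

/-- **THE UNIT-BALL SUP READING BOUNDS EVERY DIRECTION**: on a finite-dimensional fibre, `sup_{‖E‖ ≤ 1} ‖(A(δ_{x′} ⊗ E))(x)‖ ≤ K` (the shape of def-Y's
`Node00.siteKernelOfOp` kernel, an `iSup` over the closed unit ball) gives `‖(A(δ_{x′} ⊗ E))(x)‖ ≤ K` for each `‖E‖ ≤ 1` — the `iSup` is a genuine
supremum because `E ↦ (A(δ_{x′} ⊗ E))(x)` is a linear map of a finite-dimensional space, bounded on the ball.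
[cite: Balaban1985BackgroundPropagators, (3.48) p.398, (3.132) p.422, (3.187) p.432 (kernel readings), bookkeeping] -/
theorem norm_le_of_iSup_closedBall_le (A : (X → 𝔸) →ₗ[ℝ] (X → 𝔸)) (x x' : X) {K : ℝ}
    (h : (⨆ E : ↥(Metric.closedBall (0 : 𝔸) 1), ‖A (Pi.single x' (E : 𝔸)) x‖) ≤ K) (E : 𝔸) (hE : ‖E‖ ≤ 1) :
    ‖A (Pi.single x' E) x‖ ≤ K := by
  -- the direction map, as a continuous linear map of the finite-dimensional fibre
  let f : 𝔸 →ₗ[ℝ] 𝔸 := (LinearMap.proj x).comp (A.comp (LinearMap.single ℝ (fun _ : X => 𝔸) x'))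
  have hf : ∀ E : 𝔸, f E = A (Pi.single x' E) x := fun E => rfl
  have hb : BddAbove (Set.range fun E : ↥(Metric.closedBall (0 : 𝔸) 1) => ‖A (Pi.single x' (E : 𝔸)) x‖) := by
    refine ⟨‖LinearMap.toContinuousLinearMap f‖, ?_⟩
    rintro _ ⟨E, rfl⟩
    have hE1 : ‖(E : 𝔸)‖ ≤ 1 := mem_closedBall_zero_iff.mp E.2
    have h0 : 0 ≤ ‖LinearMap.toContinuousLinearMap f‖ := norm_nonneg _
    calc ‖A (Pi.single x' (E : 𝔸)) x‖ = ‖LinearMap.toContinuousLinearMap f (E : 𝔸)‖ := by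
          rw [LinearMap.coe_toContinuousLinearMap', hf]
      _ ≤ ‖LinearMap.toContinuousLinearMap f‖ * ‖(E : 𝔸)‖ := ContinuousLinearMap.le_opNorm _ _
      _ ≤ ‖LinearMap.toContinuousLinearMap f‖ * 1 := mul_le_mul_of_nonneg_left hE1 h0
      _ = ‖LinearMap.toContinuousLinearMap f‖ := mul_one _
  exact (le_ciSup hb ⟨E, mem_closedBall_zero_iff.mpr hE⟩).trans h

end DefYReading

section DefYDelta

variable {X : Type} [DecidableEq X] {𝔸 : Type} [NormedRing 𝔸]

/-- **def-Y's `deltaY w E` IS `Pi.single w E`** (any decidability instance on the carrier), so the `siteKernelOfOp` readings of NODE 00's letters are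
literally the unit-ball sup readings of §2b. [cite: Balaban1985BackgroundPropagators, (3.48) p.398 (kernels as values on δ_{y′} ⊗ E), bookkeeping] -/
theorem deltaY_eq_single (w : X) (E : 𝔸) : Node00.deltaY w E = Pi.single w E := by
  funext z
  rw [Pi.single_apply]
  unfold Node00.deltaY
  split_ifs <;> rfl

end DefYDelta

/-! ## §3  The (3.24) doors with every member row in operator currency -/

section Doors

variable {d : ℕ}

/-- ★★★ **(3.24) FOR THE GAUSSIAN OF A SECT.-E PRECISION GIVEN AS AN OPERATOR, AT EVERY COUPLING `η ∈ (0,1]`** — the precision one-stop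
`…ClassSectEMember.eq324_torus_of_expDecay_on_unit` with the member READ OFF an ℝ-linear operator `A` on `X → 𝔸`.  Class scalars FIRST: `d ≥ 1`, label count
`m`, `γ₀ > 0`, `K ≥ 0`, rate `δ > 0`, the coordinate constants `c_β, n_e ≥ 0`, and the (3.24) letters.  THEN `∃ b₁ ∀ b₀ > b₁ ∃ C ≥ 0` such that for EVERY
`η ∈ (0,1]`, torus size `N`, carrier `X`, real normed fibre `𝔸` with a symmetric pairing `β` and a frame `e : F → 𝔸` (`F ≠ ∅`) orthonormal for it, `|β(e_c,v)| ≤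
c_β‖v‖`, `‖e_c‖ ≤ n_e`, EVERY injective sub-carrier `ι : S ↪ X` (`S ≠ ∅`) placed on the torus by `site : S → (ℤ/N)^d` with labels `lab : S × F → Fin m`
(jointly injective) and a `ρ` on `S` dominating the torus sup-distance of the sites, and EVERY `A` that is `β`-self-adjoint over `X`, `γ₀`-coercive in the
`β`-form on `ι(S)`-supported frame-valued functions, with the homogeneous kernel reading `‖(A(δ_{ι s′} ⊗ E))(ι s)‖ ≤ K‖E‖e^{−δρ(s,s′)}`: the conclusion of the
one-stop for `T := 𝕄(A)` on `β := S × F` — a window `Λ ⊂ ℤ^{2d+1}`, `e′ : S × F ≃ ↥Λ` presenting `𝒩(0, 𝕄(A)⁻¹)`, the a.e. box identity, and the (3.24) pair.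
Proof: §1–§2 rows ⇒ `eq324_torus_of_expDecay_on_unit` at `(γ₀, c_βn_eK, δ)`.
[cite: Balaban1985BackgroundPropagators, (3.156)–(3.158) p.428; Balaban1985UV3, (24) p.262, (58) p.270, p.271; Balaban1982Higgs1, (3.24) p.616; BenfattoEtAl1978,
Lemma (4.5)–(4.7) p.152 (class form; ours)] -/
theorem eq324_coordMatrix_torus_on_unit (hd : 0 < d) (m : ℕ) {γ K δ cβ ne : ℝ} (hγ0 : 0 < γ) (hK : 0 ≤ K) (hδ : 0 < δ) (hcβ : 0 ≤ cβ)
    (hne : 0 ≤ ne) (t D : ℕ) {ϰ : ℝ} (hϰ : 0 < ϰ) {p₀ σ c κ : ℝ} (hp₀ : 2 / 3 < p₀) (hσ : 0 < σ) (hc : 0 ≤ c) (hκ : 0 < κ)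
    (hκσ : κ < σ * (t + 1)) :
    ∃ b₁ : ℝ, ∀ b₀ : ℝ, b₁ < b₀ → ∃ C : ℝ, 0 ≤ C ∧ ∀ η : ℝ, 0 < η → η ≤ 1 →
      ∀ {N : ℕ} [NeZero N] {X 𝔸 F S : Type} [Fintype X] [DecidableEq X] [NormedAddCommGroup 𝔸] [NormedSpace ℝ 𝔸]
        [Fintype F] [DecidableEq F] [Nonempty F] [Fintype S] [DecidableEq S] [Nonempty S]
        (β : 𝔸 →ₗ[ℝ] 𝔸 →ₗ[ℝ] ℝ), (∀ a b, β a b = β b a) →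
      ∀ (e : F → 𝔸), (∀ c c', β (e c) (e c') = if c = c' then 1 else 0) → (∀ (c : F) (v : 𝔸), |β (e c) v| ≤ cβ * ‖v‖) →
        (∀ c, ‖e c‖ ≤ ne) →
      ∀ (ι : S → X), Function.Injective ι →
      ∀ (site : S → Fin d → ZMod N) (lab : S × F → Fin m), (Function.Injective fun p : S × F => (site p.1, lab p)) →
      ∀ (ρ : S → S → ℝ), (∀ s s' i, (|((site s i - site s' i).valMinAbs : ℤ)| : ℝ) ≤ ρ s s') →
      ∀ (A : (X → 𝔸) →ₗ[ℝ] (X → 𝔸)),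
        (∀ Φ Ψ : X → 𝔸, ∑ x, β (Ψ x) (A Φ x) = ∑ x, β (A Ψ x) (Φ x)) →
        (∀ Φ : X → 𝔸, (∀ x, x ∉ Set.range ι → Φ x = 0) → (∀ x, Φ x ∈ Submodule.span ℝ (Set.range e)) →
          γ * ∑ x, β (Φ x) (Φ x) ≤ ∑ x, β (Φ x) (A Φ x)) →
        (∀ (s s' : S) (E : 𝔸), ‖A (Pi.single (ι s') E) (ι s)‖ ≤ K * ‖E‖ * Real.exp (-(δ * ρ s s'))) →
      ∃ (Λ : Finset (B1Eq324BenfattoLemma.Site (d + d + 1))) (e' : S × F ≃ ↥Λ),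
        ((gaussianFieldOfKernel fun x y => if h : x ∈ Λ ∧ y ∈ Λ then
            ((Matrix.reindex e' e' (Matrix.of fun p q : S × F => β (e p.2) (A (Pi.single (ι q.1) (e q.2)) (ι p.1))))⁻¹ : Matrix ↥Λ ↥Λ ℝ)
              ⟨x, h.1⟩ ⟨y, h.2⟩ else 0).map
            (fun (z : B1Eq324BenfattoLemma.Site (d + d + 1) → ℝ) (b : S × F) => z ((e' b : ↥Λ) : B1Eq324BenfattoLemma.Site (d + d + 1))) =
          gaussianFieldOfKernel fun b b' =>
            ((Matrix.of fun p q : S × F => β (e p.2) (A (Pi.single (ι q.1) (e q.2)) (ι p.1)))⁻¹ : Matrix (S × F) (S × F) ℝ) b b') ∧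
        (∀ p : ℝ, 0 ≤ p →
          ((fun (z : B1Eq324BenfattoLemma.Site (d + d + 1) → ℝ) (b : S × F) => z ((e' b : ↥Λ) : B1Eq324BenfattoLemma.Site (d + d + 1))) ⁻¹'
              {ω : S × F → ℝ | ∀ b, |ω b| ≤ p}) =ᵐ[gaussianFieldOfKernel fun x y => if h : x ∈ Λ ∧ y ∈ Λ then
                ((Matrix.reindex e' e' (Matrix.of fun p q : S × F => β (e p.2) (A (Pi.single (ι q.1) (e q.2)) (ι p.1))))⁻¹ : Matrix ↥Λ ↥Λ ℝ)
                  ⟨x, h.1⟩ ⟨y, h.2⟩ else 0] smallFieldSet Λ p) ∧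
        ∀ (s : ℕ) (I J : Finset (B1Eq324BenfattoLemma.Site (d + d + 1))) (a : Coef (d + d + 1)), I.Nonempty → J ⊆ I → J ⊆ Λ →
          coefSup s D a J ≤ c * η ^ σ →
          0 < ∫ z, cutoffBoltzmann (hamiltonian s D ϰ a J) I (B10.pFun b₀ p₀ η) z ∂(gaussianFieldOfKernel fun x y =>
              if h : x ∈ Λ ∧ y ∈ Λ then
                ((Matrix.reindex e' e' (Matrix.of fun p q : S × F => β (e p.2) (A (Pi.single (ι q.1) (e q.2)) (ι p.1))))⁻¹ : Matrix ↥Λ ↥Λ ℝ)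
                  ⟨x, h.1⟩ ⟨y, h.2⟩ else 0) ∧
            |Real.log (∫ z, cutoffBoltzmann (hamiltonian s D ϰ a J) I (B10.pFun b₀ p₀ η) z ∂(gaussianFieldOfKernel fun x y =>
                if h : x ∈ Λ ∧ y ∈ Λ then
                  ((Matrix.reindex e' e' (Matrix.of fun p q : S × F => β (e p.2) (A (Pi.single (ι q.1) (e q.2)) (ι p.1))))⁻¹ : Matrix ↥Λ ↥Λ ℝ)
                    ⟨x, h.1⟩ ⟨y, h.2⟩ else 0)) -
              cumulantSum (gaussianFieldOfKernel fun x y => if h : x ∈ Λ ∧ y ∈ Λ then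
                  ((Matrix.reindex e' e' (Matrix.of fun p q : S × F => β (e p.2) (A (Pi.single (ι q.1) (e q.2)) (ι p.1))))⁻¹ : Matrix ↥Λ ↥Λ ℝ)
                    ⟨x, h.1⟩ ⟨y, h.2⟩ else 0)
                (hamiltonian s D ϰ a J) t| ≤ C * η ^ κ * I.card := by
  have hK' : 0 ≤ cβ * ne * K := by positivity
  obtain ⟨b₁, hb₁⟩ := eq324_torus_of_expDecay_on_unit (d := d) hd m hγ0 hK' hδ t D hϰ hp₀ hσ hc hκ hκσ
  refine ⟨b₁, fun b₀ hb₀ => ?_⟩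
  obtain ⟨C, hC, hE⟩ := hb₁ b₀ hb₀
  refine ⟨C, hC, fun η hη hηle N _ X 𝔸 F S _ _ _ _ _ _ _ _ _ _ β hβ e he hβn hen ι hι site lab hinj ρ hρ A hA hco hker => ?_⟩
  -- §1–§2: the three member rows of `𝕄(A)` on `S × F`, with `ρ' p q := ρ p.1 q.1`
  have hTs := coordMatrix_symm_of_selfAdjoint β e ι A hβ hA
  have hγ := coercive_coordMatrix β e ι A he hι hco
  have hdec := abs_coordMatrix_le β e ι A hcβ hK ρ hβn hen hker
  have hρ' : ∀ (b b' : S × F) (i : Fin d), (|(((site ∘ Prod.fst) b i - (site ∘ Prod.fst) b' i).valMinAbs : ℤ)| : ℝ) ≤ ρ b.1 b'.1 :=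
    fun b b' i => hρ b.1 b'.1 i
  have hinj' : Function.Injective fun b : S × F => ((site ∘ Prod.fst) b, lab b) := hinj
  exact hE η hη hηle (site ∘ Prod.fst) lab hinj' (ρ := fun b b' : S × F => ρ b.1 b'.1) hTs hγ (fun b b' => hdec b b') hρ'

/-- ★★★ **(3.24) FOR `dμ_{C̃^{(k)}}` WITH NODE N06's ROWS IN OPERATOR CURRENCY, AT EVERY COUPLING `η ∈ (0,1]`** — the covariance door
`…ClassSectEMember.eq324_sectECovariance_torus_on_unit` with the member READ OFF operators: the precision `A` (print's `C*Δ_kC`) `β`-self-adjoint with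
`γ₀·Σβ(Φ,Φ) ≤ Σβ(Φ,AΦ) ≤ γ₁·Σβ(Φ,Φ)` on `ι(S)`-supported frame-valued `Φ` ([B9] p.428 γ₀, [B10] p.271 γ₁), and a sector inverse `Ã` (print's `C̃^{(k)}(Λ) =
(C*Δ_kC)⁻¹`, (3.158): `AÃ = 1` read on the frame over `ι(S)`, `Ã` frame-valued there) with the homogeneous (3.187)-type kernel reading
`‖(Ã(δ_{ι s′} ⊗ E))(ι s)‖ ≤ B‖E‖e^{−δ₀ρ(s,s′)}`.  Class scalars `γ₀, γ₁ > 0`, `B ≥ 0`, `δ₀ > 0`, `c_β, n_e ≥ 0`, label count `m` FIRST ⇒ `∃ b₁ ∀ b₀ > b₁ ∃ C ≥ 0`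
such that for EVERY `η ∈ (0,1]` and every such datum: the conclusion of the door for `T := 𝕄(A)` (presenting `𝒩(0, 𝕄(A)⁻¹)`; by §1 `𝕄(A)⁻¹ = 𝕄(Ã)`).
Proof: §1 (`coordMatrix_symm_of_selfAdjoint`, `coercive_coordMatrix`, `form_le_coordMatrix`, `inv_coordMatrix_eq`) + §2 (`abs_coordMatrix_le` for `Ã`) ⇒
`eq324_sectECovariance_torus_on_unit` at `(γ₀, γ₁, c_βn_eB, δ₀)`.
[cite: Balaban1985BackgroundPropagators, (3.157)–(3.158) p.428, Thm 3.15 (3.187) p.432; Balaban1985UV3, (58) p.270, p.271; Balaban1982Higgs1, (3.24) p.616;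
BenfattoEtAl1978, Lemma (4.5)–(4.7) p.152 (class form; ours)] -/
theorem eq324_coordMatrix_torusCovariance_on_unit (hd : 0 < d) (m : ℕ) {γ₀ γ₁ B δ₀ cβ ne : ℝ} (hγ₀ : 0 < γ₀) (hγ₁ : 0 < γ₁)
    (hB : 0 ≤ B) (hδ₀ : 0 < δ₀) (hcβ : 0 ≤ cβ) (hne : 0 ≤ ne) (t D : ℕ) {ϰ : ℝ} (hϰ : 0 < ϰ) {p₀ σ c κ : ℝ} (hp₀ : 2 / 3 < p₀)
    (hσ : 0 < σ) (hc : 0 ≤ c) (hκ : 0 < κ) (hκσ : κ < σ * (t + 1)) :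
    ∃ b₁ : ℝ, ∀ b₀ : ℝ, b₁ < b₀ → ∃ C : ℝ, 0 ≤ C ∧ ∀ η : ℝ, 0 < η → η ≤ 1 →
      ∀ {N : ℕ} [NeZero N] {X 𝔸 F S : Type} [Fintype X] [DecidableEq X] [NormedAddCommGroup 𝔸] [NormedSpace ℝ 𝔸]
        [Fintype F] [DecidableEq F] [Nonempty F] [Fintype S] [DecidableEq S] [Nonempty S]
        (β : 𝔸 →ₗ[ℝ] 𝔸 →ₗ[ℝ] ℝ), (∀ a b, β a b = β b a) →
      ∀ (e : F → 𝔸), (∀ c c', β (e c) (e c') = if c = c' then 1 else 0) → (∀ (c : F) (v : 𝔸), |β (e c) v| ≤ cβ * ‖v‖) →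
        (∀ c, ‖e c‖ ≤ ne) →
      ∀ (ι : S → X), Function.Injective ι →
      ∀ (site : S → Fin d → ZMod N) (lab : S × F → Fin m), (Function.Injective fun p : S × F => (site p.1, lab p)) →
      ∀ (ρ : S → S → ℝ), (∀ s s' i, (|((site s i - site s' i).valMinAbs : ℤ)| : ℝ) ≤ ρ s s') →
      ∀ (A Ainv : (X → 𝔸) →ₗ[ℝ] (X → 𝔸)),
        (∀ Φ Ψ : X → 𝔸, ∑ x, β (Ψ x) (A Φ x) = ∑ x, β (A Ψ x) (Φ x)) →
        (∀ Φ : X → 𝔸, (∀ x, x ∉ Set.range ι → Φ x = 0) → (∀ x, Φ x ∈ Submodule.span ℝ (Set.range e)) →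
          γ₀ * ∑ x, β (Φ x) (Φ x) ≤ ∑ x, β (Φ x) (A Φ x)) →
        (∀ Φ : X → 𝔸, (∀ x, x ∉ Set.range ι → Φ x = 0) → (∀ x, Φ x ∈ Submodule.span ℝ (Set.range e)) →
          ∑ x, β (Φ x) (A Φ x) ≤ γ₁ * ∑ x, β (Φ x) (Φ x)) →
        (∀ q : S × F, ∃ w : S × F → ℝ,
          Ainv (Pi.single (ι q.1) (e q.2)) = fun x => ∑ r, w r • (Pi.single (ι r.1) (e r.2) : X → 𝔸) x) →
        (∀ p q : S × F, β (e p.2) (A (Ainv (Pi.single (ι q.1) (e q.2))) (ι p.1)) =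
          β (e p.2) ((Pi.single (ι q.1) (e q.2) : X → 𝔸) (ι p.1))) →
        (∀ (s s' : S) (E : 𝔸), ‖Ainv (Pi.single (ι s') E) (ι s)‖ ≤ B * ‖E‖ * Real.exp (-(δ₀ * ρ s s'))) →
      ∃ (Λ : Finset (B1Eq324BenfattoLemma.Site (d + d + 1))) (e' : S × F ≃ ↥Λ),
        ((gaussianFieldOfKernel fun x y => if h : x ∈ Λ ∧ y ∈ Λ then
            (Matrix.reindex e' e'
              ((Matrix.of fun p q : S × F => β (e p.2) (A (Pi.single (ι q.1) (e q.2)) (ι p.1)))⁻¹ : Matrix (S × F) (S × F) ℝ) :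
                Matrix ↥Λ ↥Λ ℝ) ⟨x, h.1⟩ ⟨y, h.2⟩ else 0).map
            (fun (z : B1Eq324BenfattoLemma.Site (d + d + 1) → ℝ) (b : S × F) => z ((e' b : ↥Λ) : B1Eq324BenfattoLemma.Site (d + d + 1))) =
          gaussianFieldOfKernel fun b b' =>
            ((Matrix.of fun p q : S × F => β (e p.2) (A (Pi.single (ι q.1) (e q.2)) (ι p.1)))⁻¹ : Matrix (S × F) (S × F) ℝ) b b') ∧
        (∀ p : ℝ, 0 ≤ p →
          ((fun (z : B1Eq324BenfattoLemma.Site (d + d + 1) → ℝ) (b : S × F) => z ((e' b : ↥Λ) : B1Eq324BenfattoLemma.Site (d + d + 1))) ⁻¹'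
              {ω : S × F → ℝ | ∀ b, |ω b| ≤ p}) =ᵐ[gaussianFieldOfKernel fun x y => if h : x ∈ Λ ∧ y ∈ Λ then
                (Matrix.reindex e' e'
                  ((Matrix.of fun p q : S × F => β (e p.2) (A (Pi.single (ι q.1) (e q.2)) (ι p.1)))⁻¹ : Matrix (S × F) (S × F) ℝ) :
                    Matrix ↥Λ ↥Λ ℝ) ⟨x, h.1⟩ ⟨y, h.2⟩ else 0] smallFieldSet Λ p) ∧
        ∀ (s : ℕ) (I J : Finset (B1Eq324BenfattoLemma.Site (d + d + 1))) (a : Coef (d + d + 1)), I.Nonempty → J ⊆ I → J ⊆ Λ →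
          coefSup s D a J ≤ c * η ^ σ →
          0 < ∫ z, cutoffBoltzmann (hamiltonian s D ϰ a J) I (B10.pFun b₀ p₀ η) z ∂(gaussianFieldOfKernel fun x y =>
              if h : x ∈ Λ ∧ y ∈ Λ then
                (Matrix.reindex e' e'
                  ((Matrix.of fun p q : S × F => β (e p.2) (A (Pi.single (ι q.1) (e q.2)) (ι p.1)))⁻¹ : Matrix (S × F) (S × F) ℝ) :
                    Matrix ↥Λ ↥Λ ℝ) ⟨x, h.1⟩ ⟨y, h.2⟩ else 0) ∧
            |Real.log (∫ z, cutoffBoltzmann (hamiltonian s D ϰ a J) I (B10.pFun b₀ p₀ η) z ∂(gaussianFieldOfKernel fun x y =>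
                if h : x ∈ Λ ∧ y ∈ Λ then
                  (Matrix.reindex e' e'
                    ((Matrix.of fun p q : S × F => β (e p.2) (A (Pi.single (ι q.1) (e q.2)) (ι p.1)))⁻¹ : Matrix (S × F) (S × F) ℝ) :
                      Matrix ↥Λ ↥Λ ℝ) ⟨x, h.1⟩ ⟨y, h.2⟩ else 0)) -
              cumulantSum (gaussianFieldOfKernel fun x y => if h : x ∈ Λ ∧ y ∈ Λ then
                  (Matrix.reindex e' e'
                    ((Matrix.of fun p q : S × F => β (e p.2) (A (Pi.single (ι q.1) (e q.2)) (ι p.1)))⁻¹ : Matrix (S × F) (S × F) ℝ) :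
                      Matrix ↥Λ ↥Λ ℝ) ⟨x, h.1⟩ ⟨y, h.2⟩ else 0)
                (hamiltonian s D ϰ a J) t| ≤ C * η ^ κ * I.card := by
  have hB' : 0 ≤ cβ * ne * B := by positivity
  obtain ⟨b₁, hb₁⟩ := eq324_sectECovariance_torus_on_unit (d := d) hd m hγ₀ hγ₁ hB' hδ₀ t D hϰ hp₀ hσ hc hκ hκσ
  refine ⟨b₁, fun b₀ hb₀ => ?_⟩
  obtain ⟨C, hC, hE⟩ := hb₁ b₀ hb₀
  refine ⟨C, hC, fun η hη hηle N _ X 𝔸 F S _ _ _ _ _ _ _ _ _ _ β hβ e he hβn hen ι hι site lab hinj ρ hρ A Ainv hA hlow hup hval hinv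
    hker => ?_⟩
  -- §1–§2: the four member rows of `T := 𝕄(A)` on `S × F`, with `T⁻¹ = 𝕄(Ã)`
  have hTs := coordMatrix_symm_of_selfAdjoint β e ι A hβ hA
  have hγ := coercive_coordMatrix β e ι A he hι hlow
  have hγ' := form_le_coordMatrix β e ι A he hι hup
  have hInv := inv_coordMatrix_eq β e ι A he hι Ainv hval hinv
  have hdec : ∀ b b' : S × F,
      |((Matrix.of fun p q : S × F => β (e p.2) (A (Pi.single (ι q.1) (e q.2)) (ι p.1)))⁻¹ : Matrix (S × F) (S × F) ℝ) b b'| ≤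
        cβ * ne * B * Real.exp (-(δ₀ * ρ b.1 b'.1)) := by
    intro b b'
    rw [hInv]
    exact abs_coordMatrix_le β e ι Ainv hcβ hB ρ hβn hen hker b b'
  have hρ' : ∀ (b b' : S × F) (i : Fin d), (|(((site ∘ Prod.fst) b i - (site ∘ Prod.fst) b' i).valMinAbs : ℤ)| : ℝ) ≤ ρ b.1 b'.1 :=
    fun b b' i => hρ b.1 b'.1 i
  have hinj' : Function.Injective fun b : S × F => ((site ∘ Prod.fst) b, lab b) := hinj
  exact hE η hη hηle (site ∘ Prod.fst) lab hinj' (ρ := fun b b' : S × F => ρ b.1 b'.1) hTs hγ hγ' hdec hρ'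

/-- Non-vacuity of the scalar side of `eq324_coordMatrix_torus_on_unit` (the binder list elaborates end to end): `d = 3`, `m = 24`, `γ₀ = 1`, `K = 1`, `δ = 1`,
`c_β = n_e = 1`, and the (α)-socket's letters `t = 6`, `D = 4`, `ϰ = 1`, `p₀ = 1`, `σ = 1/2`, `c = 1`, `κ = 13/4 < σ(t+1) = 7/2`.
[cite: Balaban1985UV3, (24) p.262 (letters of the socket; instance ours)] -/
example :=
  eq324_coordMatrix_torus_on_unit (d := 3) (by norm_num) 24 (γ := 1) (K := 1) (δ := 1) (cβ := 1) (ne := 1) one_pos zero_le_one one_pos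
    zero_le_one zero_le_one 6 4 (ϰ := 1) one_pos (p₀ := 1) (σ := 1 / 2) (c := 1) (κ := 13 / 4) (by norm_num) (by norm_num) zero_le_one
    (by norm_num) (by norm_num)

/-- Non-vacuity of the scalar side of `eq324_coordMatrix_torusCovariance_on_unit`: `d = 3`, `m = 24`, `γ₀ = 1`, `γ₁ = 5`, `B = 2`, `δ₀ = 1/3`, `c_β = n_e = 1`,
socket letters as above. [cite: Balaban1985UV3, (58) p.270, p.271 (letters; instance ours)] -/
example :=
  eq324_coordMatrix_torusCovariance_on_unit (d := 3) (by norm_num) 24 (γ₀ := 1) (γ₁ := 5) (B := 2) (δ₀ := 1 / 3) (cβ := 1) (ne := 1)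
    one_pos (by norm_num) (by norm_num) (by norm_num) zero_le_one zero_le_one 6 4 (ϰ := 1) one_pos (p₀ := 1) (σ := 1 / 2) (c := 1)
    (κ := 13 / 4) (by norm_num) (by norm_num) zero_le_one (by norm_num) (by norm_num)

end Doors

/-! ## §4  The fibre `M_N(ℂ)` at seat n06-d's real trace basis: the symmetry and `γ₀` rows read at the cell's trace-currency predicates -/

section TraceFibre

open B9Thm311ReadingCoords (trIP IsSymmTr)
open B9CoReadingCoordsTranspose (trReForm trReForm_apply trReForm_symm sum_trReForm_eq_trIP TrIdx trBasis trBasis_repr_eq_trace)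

variable {N : ℕ} {X : Type} [Fintype X] [DecidableEq X] {S : Type} [Fintype S] [DecidableEq S] (ι : S → X)

/-- **ORTHONORMALITY INHABITED**: seat n06-d's real trace basis of `M_N(ℂ)` is orthonormal for the real trace pairing `Re tr(vᴴw)` in the shape of §1's
hypothesis `he`. [cite: Balaban1985BackgroundPropagators, p.393 (scalar products), bookkeeping] -/
theorem trReForm_trBasis_trBasis (c c' : TrIdx N) : trReForm (trBasis N c) (trBasis N c') = if c = c' then 1 else 0 := by
  rw [trReForm_apply, ← trBasis_repr_eq_trace, Module.Basis.repr_self, Finsupp.single_apply]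
  by_cases h : c = c'
  · rw [if_pos h, if_pos h.symm]
  · rw [if_neg h, if_neg (fun h' => h h'.symm)]

omit [DecidableEq X] in
/-- the §1 coordinate of an `M_N(ℂ)`-valued function at `trBasis` IS seat n06-d's basis coordinate: `trReForm (trBasis c) v = repr_c v`.
[cite: Balaban1985BackgroundPropagators, p.393, bookkeeping] -/
theorem trReForm_trBasis_eq_repr (v : Matrix (Fin N) (Fin N) ℂ) (c : TrIdx N) : trReForm (trBasis N c) v = (trBasis N).repr v c := by
  rw [trReForm_apply, trBasis_repr_eq_trace]

omit [DecidableEq X] in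
/-- a `ℂ`-linear letter symmetric for the weight-one trace pairing (seat n06-j's `IsSymmTr 1`, e.g. def-Y's `OpsYSectDESymm.QG1QinvY_isSymmTr`) is
`trReForm`-self-adjoint over the carrier in the shape of §1's hypothesis. [cite: Balaban1985BackgroundPropagators, Thm 3.11 p.416 («symmetric»), p.393, bookkeeping] -/
theorem selfAdjoint_of_isSymmTr (T : (X → Matrix (Fin N) (Fin N) ℂ) →ₗ[ℂ] (X → Matrix (Fin N) (Fin N) ℂ)) (hT : IsSymmTr (fun _ => (1 : ℝ)) T)
    (Φ Ψ : X → Matrix (Fin N) (Fin N) ℂ) :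
    ∑ x, trReForm (Ψ x) (T.restrictScalars ℝ Φ x) = ∑ x, trReForm (T.restrictScalars ℝ Ψ x) (Φ x) := by
  simp only [LinearMap.coe_restrictScalars]
  rw [sum_trReForm_eq_trIP, sum_trReForm_eq_trIP]
  exact (hT Ψ Φ).symm

omit [Fintype S] [DecidableEq S] in
/-- ★ **THE SYMMETRY ROW AT THE TRACE BASIS**: for a `ℂ`-linear letter `T` on `X → M_N(ℂ)` with `IsSymmTr 1 T`, the coordinate matrix
`𝕄 p q = Re tr((E_{p.2})ᴴ (T(δ_{ι q.1} ⊗ E_{q.2}))(ι p.1))` along any sub-carrier is symmetric. [cite: Balaban1985BackgroundPropagators, Thm 3.11 p.416, Sect. E p.428; Balaban1985UV3, p.271, dictionary] -/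
theorem coordMatrix_symm_trBasis_of_isSymmTr (T : (X → Matrix (Fin N) (Fin N) ℂ) →ₗ[ℂ] (X → Matrix (Fin N) (Fin N) ℂ))
    (hT : IsSymmTr (fun _ => (1 : ℝ)) T) (p q : S × TrIdx N) :
    (Matrix.of fun p q : S × TrIdx N => trReForm (trBasis N p.2) (T.restrictScalars ℝ (Pi.single (ι q.1) (trBasis N q.2)) (ι p.1))) p q =
      (Matrix.of fun p q : S × TrIdx N => trReForm (trBasis N p.2) (T.restrictScalars ℝ (Pi.single (ι q.1) (trBasis N q.2)) (ι p.1))) q p :=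
  coordMatrix_symm_of_selfAdjoint trReForm (fun c => trBasis N c) ι (T.restrictScalars ℝ) trReForm_symm (selfAdjoint_of_isSymmTr T hT) p q

/-- ★ **THE `γ₀` ROW AT THE TRACE BASIS**: `γ₀·trIP 1 Φ Φ ≤ trIP 1 Φ (TΦ)` for every `Φ` supported on `ι(S)` (print's lower bound of `C*Δ_kC` on the
B̃-variables, in seat n06-j's trace currency) gives the `γ₀`-coercivity of the coordinate matrix along the injective sub-carrier `ι`.
[cite: Balaban1985BackgroundPropagators, Sect. E p.428 (γ₀; GAPS G-B9-09); Balaban1985UV3, p.271, dictionary] -/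
theorem coercive_coordMatrix_trBasis_of_trIP (hι : Function.Injective ι)
    (T : (X → Matrix (Fin N) (Fin N) ℂ) →ₗ[ℂ] (X → Matrix (Fin N) (Fin N) ℂ)) {γ : ℝ}
    (hco : ∀ Φ : X → Matrix (Fin N) (Fin N) ℂ, (∀ x, x ∉ Set.range ι → Φ x = 0) →
      γ * trIP (fun _ => (1 : ℝ)) Φ Φ ≤ trIP (fun _ => (1 : ℝ)) Φ (T Φ)) (v : S × TrIdx N → ℝ) :
    γ * ∑ p, v p ^ 2 ≤ ∑ p, ∑ q, (Matrix.of fun p q : S × TrIdx N =>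
      trReForm (trBasis N p.2) (T.restrictScalars ℝ (Pi.single (ι q.1) (trBasis N q.2)) (ι p.1))) p q * v p * v q :=
  coercive_coordMatrix trReForm (fun c => trBasis N c) ι (T.restrictScalars ℝ) trReForm_trBasis_trBasis hι
    (fun Φ hΦ _ => by
      rw [LinearMap.coe_restrictScalars, sum_trReForm_eq_trIP, sum_trReForm_eq_trIP]
      exact hco Φ hΦ) v

/-- ★ **THE `γ₁` ROW AT THE TRACE BASIS**: `trIP 1 Φ (TΦ) ≤ γ₁·trIP 1 Φ Φ` on `ι(S)`-supported `Φ` ([B10] p.271 «γ₁ is an upper bound of … C*Δ_kC») gives the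
`γ₁` form bound of the coordinate matrix. [cite: Balaban1985UV3, p.271; Balaban1985BackgroundPropagators, p.428, dictionary] -/
theorem form_le_coordMatrix_trBasis_of_trIP (hι : Function.Injective ι)
    (T : (X → Matrix (Fin N) (Fin N) ℂ) →ₗ[ℂ] (X → Matrix (Fin N) (Fin N) ℂ)) {γ₁ : ℝ}
    (hup : ∀ Φ : X → Matrix (Fin N) (Fin N) ℂ, (∀ x, x ∉ Set.range ι → Φ x = 0) →
      trIP (fun _ => (1 : ℝ)) Φ (T Φ) ≤ γ₁ * trIP (fun _ => (1 : ℝ)) Φ Φ) (v : S × TrIdx N → ℝ) :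
    ∑ p, ∑ q, (Matrix.of fun p q : S × TrIdx N =>
      trReForm (trBasis N p.2) (T.restrictScalars ℝ (Pi.single (ι q.1) (trBasis N q.2)) (ι p.1))) p q * v p * v q ≤ γ₁ * ∑ p, v p ^ 2 :=
  form_le_coordMatrix trReForm (fun c => trBasis N c) ι (T.restrictScalars ℝ) trReForm_trBasis_trBasis hι
    (fun Φ hΦ _ => by
      rw [LinearMap.coe_restrictScalars, sum_trReForm_eq_trIP, sum_trReForm_eq_trIP]
      exact hup Φ hΦ) v

end TraceFibre

end Literature.MathematicalPhysics.QuantumFieldTheory.Balaban1983to89.B1Eq324BenfattoClassSectEMemberCoRead
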